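import Literature.NumberTheory.ModularForms.PoincareSeriesWeightTwoHecke
import Literature.NumberTheory.LFunctions.WeightTwoBesselModeIntegral
import Literature.Analysis.Complex.StripShiftFourierDecay
import Literature.Analysis.SpecialFunctions.InvSqAddSqIntegral
import Mathlib.Analysis.SpecialFunctions.Pow.Deriv
import HarnessLib

/-!
# The cell integral of the weight-2 Hecke–Poincaré series: analytic continuation in `t`,
# exponential decay in the frequency, the limit `s → 0⁺`, and the values at `s = 0`

Topic `Literature/NumberTheory/ModularForms` (namespace `Literature.NumberTheory.ModularForms.PoincareWeightTwo`,
continuing the definitions file `PoincareSeriesWeightTwoHecke.lean`). THEOREMS about the tree's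
`modeIntegral s A B y = ∫_ℝ (t+iy)⁻² |t+iy|^{−2s} e(−A/(t+iy)) e(−Bt) dt` (Iwaniec–Kowalski, proof of
Lemma 14.2 at `k = 2` with Hecke's factor `|j|^{−2s}`, §3.2), plus ONE definition with body, the
holomorphic kernel `modeKernel` (the integrand continued to complex `t`); no named fact.

* `modeKernel s A y w = (w+iy)⁻² (w²+y²)^{−s} e(−A/(w+iy))` — for real `t`, `(t²+y²)^{−s} = |t+iy|^{−2s}`,
  and `w² + y²` stays in the slit plane on the strip `|Im w| < y`, so the principal power is
  holomorphic there (`differentiableAt_modeKernel`); `modeIntegral_eq_integral_modeKernel`.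
* `norm_modeKernel_le` — on `|Im w| ≤ y/2`: `‖modeKernel s A y w‖ ≤ (y/2)^{−2s} (Re w² + (y/2)²)⁻¹`
  (`s, A ≥ 0`).
* `norm_modeIntegral_le` — **exponential decay in the frequency**:
  `‖I_s(A, B; y)‖ ≤ (2π/y) (y/2)^{−2s} e^{−π|B|y}` for `s ≥ 0`, `A ≥ 0`, `y > 0`, all real `B`
  (contour shift to `Im t = ∓y/2`, the tree's `norm_integral_mul_cexp_le_of_two_sided_strip`).
* `tendsto_modeIntegral_nhdsGT_zero` — `I_s → I_0` as `s → 0⁺` (dominated convergence).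
* `modeIntegral_zero_eq_of_pos` — `I_0(A, B; y) = e^{−2πBy} · (−2π√(B/A) J₁(4π√(AB)))` for
  `A, B > 0` (the tree's `weightTwo_besselModeIntegral`).
* `modeIntegral_zero_eq_zero_of_nonpos` — `I_0(A, B; y) = 0` for `B ≤ 0`, `A ≥ 0` (shift the line
  to `Im t = Y → +∞`).

These are the handles of the pointwise Hecke limit `s → 0⁺` (stub T3 of the I1 skeleton
`Summits/Parity/GeneralizedHardyLittlewood/Cruxes/PeterssonBoundPrinted/Lines/poincare_hecke.lean`,
Kowalski–Michel 2000 Petersson formula, stmt-Parity-20404).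

## References

* [IwaniecKowalski2004] H. Iwaniec, E. Kowalski, *Analytic Number Theory*, AMS Colloq. Publ. 53,
  §14.2 (proof of Lemma 14.2), §3.2 (Hecke's trick).
* [Iwaniec2002] H. Iwaniec, *Spectral Methods of Automorphic Forms*, §3.2 (the same cell integrals).
-/

noncomputable section

open scoped Real Topology
open Complex MeasureTheory Filter Set

namespace Literature.NumberTheory.ModularForms.PoincareWeightTwo

/-! ## The holomorphic kernel -/

/-- The integrand of `modeIntegral` continued to complex `t = w`, without the character `e(−Bt)`:
`(w+iy)⁻² (w²+y²)^{−s} e(−A/(w+iy))` (principal power; on the real line `(t²+y²)^{−s} = |t+iy|^{−2s}`).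
[cite: IwaniecKowalski2004, §14.2 (proof of Lemma 14.2)] -/
def modeKernel (s A y : ℝ) (w : ℂ) : ℂ :=
  ((w + y * I) ^ 2)⁻¹ * (w ^ 2 + (y : ℂ) ^ 2) ^ (-(s : ℂ)) *
    cexp (2 * π * I * (-(A : ℂ) / (w + y * I)))

/-- On the real line the kernel times the character is the integrand of `modeIntegral`:
`|t+iy|^{−2s} = (t²+y²)^{−s}` and `e(−A/(t+iy) − Bt) = e(−A/(t+iy)) · e^{−2πiBt}`.
[cite: IwaniecKowalski2004, §14.2 (proof of Lemma 14.2)] -/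
theorem modeKernel_ofReal_mul_cexp (s A B y t : ℝ) :
    modeKernel s A y t * cexp (((-(2 * π * B) : ℝ) : ℂ) * t * I) =
      (((t : ℂ) + y * I) ^ 2)⁻¹ * ((‖(t : ℂ) + y * I‖ ^ (-(2 * s)) : ℝ) : ℂ) *
        cexp (2 * π * I * (-(A : ℂ) / ((t : ℂ) + y * I) - B * t)) := by
  have hnorm : ‖(t : ℂ) + y * I‖ ^ (-(2 * s)) = (t ^ 2 + y ^ 2) ^ (-s) := by
    rw [Complex.norm_add_mul_I, Real.sqrt_eq_rpow, ← Real.rpow_mul (by positivity)]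
    congr 1
    ring
  have hpow : ((t : ℂ) ^ 2 + (y : ℂ) ^ 2) ^ (-(s : ℂ)) =
      ((‖(t : ℂ) + y * I‖ ^ (-(2 * s)) : ℝ) : ℂ) := by
    rw [hnorm, Complex.ofReal_cpow (by positivity) (-s)]
    push_cast
    rfl
  unfold modeKernel
  rw [hpow, mul_assoc, ← Complex.exp_add]
  congr 2
  push_cast
  ring

/-- The cell integral as the integral of the holomorphic kernel against the character
`e^{−2πiBt}`. [cite: IwaniecKowalski2004, §14.2 (proof of Lemma 14.2)] -/
theorem modeIntegral_eq_integral_modeKernel (s A B y : ℝ) :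
    modeIntegral s A B y = ∫ t : ℝ, modeKernel s A y t * cexp (((-(2 * π * B) : ℝ) : ℂ) * t * I) := by
  unfold modeIntegral
  refine integral_congr_ae (Eventually.of_forall fun t => ?_)
  exact (modeKernel_ofReal_mul_cexp s A B y t).symm

/-- `w + iy ≠ 0` when `Im w > −y`. [folklore] -/
private theorem add_mul_I_ne_zero_of_im {y : ℝ} {w : ℂ} (hw : -y < w.im) : w + y * I ≠ 0 := by
  intro h
  have := congrArg Complex.im h
  simp at this
  linarith

/-- On the strip `|Im w| < y` the quantity `w² + y²` lies in the slit plane (its real part is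
positive when `Re w · Im w = 0`, otherwise its imaginary part `2 Re w Im w` is non-zero).
[folklore] -/
private theorem sq_add_sq_mem_slitPlane {y : ℝ} {w : ℂ} (hw : |w.im| < y) :
    w ^ 2 + (y : ℂ) ^ 2 ∈ slitPlane := by
  rw [Complex.mem_slitPlane_iff]
  have hre : (w ^ 2 + (y : ℂ) ^ 2).re = w.re ^ 2 - w.im ^ 2 + y ^ 2 := by
    simp [sq, Complex.mul_re]
  have him : (w ^ 2 + (y : ℂ) ^ 2).im = 2 * w.re * w.im := by
    simp [sq, Complex.mul_im]; ring
  have hlt := abs_lt.mp hw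
  rcases eq_or_ne w.im 0 with h0 | h0
  · left
    rw [hre, h0]
    have : 0 < y := by linarith
    nlinarith [sq_nonneg w.re]
  · rcases eq_or_ne w.re 0 with h1 | h1
    · left
      rw [hre, h1]
      have hy : 0 < y := lt_of_le_of_lt (abs_nonneg _) hw
      have : w.im ^ 2 < y ^ 2 := by
        rw [← sq_abs]
        exact pow_lt_pow_left₀ hw (abs_nonneg _) two_ne_zero
      linarith
    · right
      rw [him]
      exact mul_ne_zero (mul_ne_zero two_ne_zero h1) h0

/-- **Holomorphy of the kernel on the strip `|Im w| < y`.** [cite: IwaniecKowalski2004, §14.2 (proof of Lemma 14.2)] -/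
theorem differentiableAt_modeKernel (s A : ℝ) {y : ℝ} {w : ℂ} (hw : |w.im| < y) :
    DifferentiableAt ℂ (modeKernel s A y) w := by
  have hW : w + y * I ≠ 0 := add_mul_I_ne_zero_of_im (abs_lt.mp hw).1
  have h1 : DifferentiableAt ℂ (fun w : ℂ => ((w + y * I) ^ 2)⁻¹) w :=
    ((differentiableAt_id.add_const _).pow 2).inv (pow_ne_zero 2 hW)
  have h2 : DifferentiableAt ℂ (fun w : ℂ => (w ^ 2 + (y : ℂ) ^ 2) ^ (-(s : ℂ))) w :=
    ((differentiableAt_id.pow 2).add_const _).cpow_const (sq_add_sq_mem_slitPlane hw)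
  have hd : DifferentiableAt ℂ (fun w : ℂ => w + y * I) w := differentiableAt_id.add_const _
  have h3 : DifferentiableAt ℂ (fun w : ℂ => cexp (2 * π * I * (-(A : ℂ) / (w + y * I)))) w :=
    (((differentiableAt_const (-(A : ℂ))).div hd hW).const_mul (2 * π * I)).cexp
  exact (h1.mul h2).mul h3

/-- Holomorphy on the open strip and continuity on every closed sub-strip `|Im w| ≤ Y`, `Y < y`.
[cite: IwaniecKowalski2004, §14.2 (proof of Lemma 14.2)] -/
theorem differentiableOn_modeKernel (s A y : ℝ) :
    DifferentiableOn ℂ (modeKernel s A y) {w : ℂ | |w.im| < y} :=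
  fun _ hw => (differentiableAt_modeKernel s A hw).differentiableWithinAt

/-! ## The size of the kernel on the half-width strip -/

/-- `|e(−A/W)| ≤ 1` for `A ≥ 0` and `Im W > 0` (`Im(−A/W) = A Im W/|W|² ≥ 0`). [folklore] -/
private theorem norm_cexp_neg_div_le_one {A : ℝ} (hA : 0 ≤ A) {W : ℂ} (hW : 0 < W.im) :
    ‖cexp (2 * π * I * (-(A : ℂ) / W))‖ ≤ 1 := by
  rw [Complex.norm_exp, Real.exp_le_one_iff]
  have him : (-(A : ℂ) / W).im = A * W.im / Complex.normSq W := by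
    rw [Complex.div_im]
    simp
    ring
  have hre : (2 * π * I * (-(A : ℂ) / W)).re = -(2 * π) * (-(A : ℂ) / W).im := by
    simp [Complex.mul_re]
  rw [hre, him]
  have hn : 0 < Complex.normSq W := Complex.normSq_pos.mpr (by
    intro h; rw [h] at hW; simp at hW)
  have : 0 ≤ A * W.im / Complex.normSq W := by positivity
  nlinarith [Real.pi_pos]

/-- **The kernel on the strip `|Im w| ≤ y/2`:** for `s ≥ 0`, `A ≥ 0`, `y > 0`,
`‖modeKernel s A y w‖ ≤ (y/2)^{−2s} (Re w² + (y/2)²)⁻¹` (`|w+iy| ≥ Im w + y ≥ y/2`,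
`|w²+y²| = |w+iy||w−iy| ≥ (y/2)²`, `|e(−A/(w+iy))| ≤ 1`). [cite: IwaniecKowalski2004, §14.2 (proof of Lemma 14.2)] -/
theorem norm_modeKernel_le {s A y : ℝ} (hs : 0 ≤ s) (hA : 0 ≤ A) (hy : 0 < y) {w : ℂ}
    (hw : |w.im| ≤ y / 2) :
    ‖modeKernel s A y w‖ ≤ (y / 2) ^ (-(2 * s)) * (w.re ^ 2 + (y / 2) ^ 2)⁻¹ := by
  obtain ⟨hw1, hw2⟩ := abs_le.mp hw
  have hIm : y / 2 ≤ (w + y * I).im := by simp; linarith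
  have hIm' : y / 2 ≤ -(w - y * I).im := by simp; linarith
  have hWpos : 0 < (w + y * I).im := lt_of_lt_of_le (by positivity) hIm
  -- `|w + iy|² ≥ Re w² + (y/2)²`
  have hsq : w.re ^ 2 + (y / 2) ^ 2 ≤ ‖w + y * I‖ ^ 2 := by
    rw [Complex.sq_norm, Complex.normSq_apply]
    have h1 : (w + y * I).re = w.re := by simp
    rw [h1]
    have h2 : (y / 2) ^ 2 ≤ (w + y * I).im * (w + y * I).im := by
      rw [sq]; exact mul_self_le_mul_self (by positivity) hIm
    nlinarith [h2]
  have hpos : 0 < w.re ^ 2 + (y / 2) ^ 2 := by positivity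
  have hA1 : ‖((w + y * I) ^ 2)⁻¹‖ ≤ (w.re ^ 2 + (y / 2) ^ 2)⁻¹ := by
    rw [norm_inv, norm_pow]
    exact inv_anti₀ hpos hsq
  -- `|w² + y²| ≥ (y/2)²`
  have hfac : w ^ 2 + (y : ℂ) ^ 2 = (w + y * I) * (w - y * I) := by
    ring_nf; rw [Complex.I_sq]; ring
  have hge1 : y / 2 ≤ ‖w + y * I‖ := hIm.trans (Complex.im_le_norm _)
  have hge2 : y / 2 ≤ ‖w - y * I‖ := by
    refine hIm'.trans ?_
    have := Complex.abs_im_le_norm (w - y * I)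
    exact (neg_le_abs _).trans this
  have hprod : (y / 2) ^ 2 ≤ ‖w ^ 2 + (y : ℂ) ^ 2‖ := by
    rw [hfac, norm_mul, sq]
    exact mul_le_mul hge1 hge2 (by positivity) (norm_nonneg _)
  have hA2 : ‖(w ^ 2 + (y : ℂ) ^ 2) ^ (-(s : ℂ))‖ ≤ (y / 2) ^ (-(2 * s)) := by
    rw [show (-(s : ℂ)) = ((-s : ℝ) : ℂ) by push_cast; ring, Complex.norm_cpow_real]
    calc ‖w ^ 2 + (y : ℂ) ^ 2‖ ^ (-s) ≤ ((y / 2) ^ 2) ^ (-s) :=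
          Real.rpow_le_rpow_of_nonpos (by positivity) hprod (by linarith)
      _ = (y / 2) ^ (-(2 * s)) := by
          rw [← Real.rpow_natCast, ← Real.rpow_mul (by positivity)]
          congr 1; push_cast; ring
  have hA3 : ‖cexp (2 * π * I * (-(A : ℂ) / (w + y * I)))‖ ≤ 1 := norm_cexp_neg_div_le_one hA hWpos
  unfold modeKernel
  rw [norm_mul, norm_mul]
  calc ‖((w + y * I) ^ 2)⁻¹‖ * ‖(w ^ 2 + (y : ℂ) ^ 2) ^ (-(s : ℂ))‖ *
        ‖cexp (2 * π * I * (-(A : ℂ) / (w + y * I)))‖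
      ≤ (w.re ^ 2 + (y / 2) ^ 2)⁻¹ * (y / 2) ^ (-(2 * s)) * 1 := by
        gcongr
    _ = (y / 2) ^ (-(2 * s)) * (w.re ^ 2 + (y / 2) ^ 2)⁻¹ := by ring

/-! ## Exponential decay of the cell integral in the frequency -/

/-- **Exponential decay of the cell integral in the frequency `B`** (contour shift to
`Im t = ∓y/2` inside the strip of holomorphy `|Im t| < y`): for `s ≥ 0`, `A ≥ 0`, `y > 0` and
every real `B`, `‖I_s(A, B; y)‖ ≤ (2π/y) (y/2)^{−2s} e^{−π|B|y}`.
[cite: IwaniecKowalski2004, §14.2 (proof of Lemma 14.2)] -/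
theorem norm_modeIntegral_le {s A y : ℝ} (hs : 0 ≤ s) (hA : 0 ≤ A) (hy : 0 < y) (B : ℝ) :
    ‖modeIntegral s A B y‖ ≤ 2 * π / y * (y / 2) ^ (-(2 * s)) * Real.exp (-(π * |B| * y)) := by
  set b : ℝ → ℝ := fun x => (y / 2) ^ (-(2 * s)) * (x ^ 2 + (y / 2) ^ 2)⁻¹ with hb_def
  have hy2 : 0 < y / 2 := by positivity
  have hgc : ContinuousOn (modeKernel s A y) {z : ℂ | |z.im| ≤ y / 2} :=
    (differentiableOn_modeKernel s A y).continuousOn.mono fun z hz => by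
      simp only [Set.mem_setOf_eq] at hz ⊢; linarith
  have hgd : DifferentiableOn ℂ (modeKernel s A y) {z : ℂ | |z.im| < y / 2} :=
    (differentiableOn_modeKernel s A y).mono fun z hz => by
      simp only [Set.mem_setOf_eq] at hz ⊢; linarith
  have hgb : ∀ z : ℂ, |z.im| ≤ y / 2 → ‖modeKernel s A y z‖ ≤ b z.re := fun z hz =>
    norm_modeKernel_le hs hA hy hz
  have hbi : Integrable b :=
    (Literature.Analysis.SpecialFunctions.integrable_inv_sq_add_sq_of_ne_zero' hy2.ne').const_mul _
  have htop : Tendsto b atTop (𝓝 0) := by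
    have h1 : Tendsto (fun x : ℝ => x ^ 2 + (y / 2) ^ 2) atTop atTop :=
      tendsto_atTop_add_const_right _ _ (tendsto_pow_atTop two_ne_zero)
    simpa [hb_def] using (tendsto_inv_atTop_zero.comp h1).const_mul ((y / 2) ^ (-(2 * s)))
  have hbot : Tendsto b atBot (𝓝 0) := by
    have := htop.comp tendsto_neg_atBot_atTop
    refine this.congr fun t => ?_
    simp [hb_def, Function.comp]
  have hint : ∫ x : ℝ, b x = (y / 2) ^ (-(2 * s)) * (π / (y / 2)) := by
    simp only [hb_def]
    rw [integral_const_mul, Literature.Analysis.SpecialFunctions.integral_inv_sq_add_sq_eq_pi_div' hy2]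
  have key := Literature.Analysis.Complex.norm_integral_mul_cexp_le_of_two_sided_strip hy2.le hgc hgd
    hgb hbi htop hbot (-(2 * π * B))
  rw [modeIntegral_eq_integral_modeKernel, show ((-(2 * π * B) : ℝ) : ℂ) = ((-(2 * π * B) : ℝ) : ℂ)
    from rfl]
  refine key.trans_eq ?_
  rw [hint, abs_neg, abs_mul, abs_of_pos (by positivity : (0 : ℝ) < 2 * π)]
  have : -(y / 2 * (2 * π * |B|)) = -(π * |B| * y) := by ring
  rw [this]
  field_simp

/-! ## The limit `s → 0⁺` of the cell integral -/

/-- `y^{−2s} ≤ max(1, y⁻²)` for `0 ≤ s ≤ 1`, `y > 0`. [folklore] -/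
private theorem rpow_neg_two_mul_le_max {y s : ℝ} (hy : 0 < y) (hs0 : 0 ≤ s) (hs1 : s ≤ 1) :
    y ^ (-(2 * s)) ≤ max 1 (y ^ (-2 : ℝ)) := by
  rcases le_or_gt 1 y with h | h
  · exact (Real.rpow_le_one_of_one_le_of_nonpos h (by linarith)).trans (le_max_left _ _)
  · exact (Real.rpow_le_rpow_of_exponent_ge hy h.le (by linarith)).trans (le_max_right _ _)

/-- The integrand of `modeIntegral` is continuous in `t`. [cite: IwaniecKowalski2004, §14.2 (proof of Lemma 14.2)] -/
theorem continuous_modeIntegrand (s A B : ℝ) {y : ℝ} (hy : 0 < y) :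
    Continuous fun t : ℝ => (((t : ℂ) + y * I) ^ 2)⁻¹ * ((‖(t : ℂ) + y * I‖ ^ (-(2 * s)) : ℝ) : ℂ) *
      cexp (2 * π * I * (-(A : ℂ) / ((t : ℂ) + y * I) - B * t)) := by
  have hne : ∀ t : ℝ, (t : ℂ) + y * I ≠ 0 := fun t =>
    add_mul_I_ne_zero_of_im (by simp; linarith)
  have hc : Continuous fun t : ℝ => (t : ℂ) + y * I := by fun_prop
  refine ((Continuous.inv₀ (hc.pow 2) fun t => pow_ne_zero 2 (hne t)).mul ?_).mul ?_
  · refine Complex.continuous_ofReal.comp ?_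
    exact (continuous_norm.comp hc).rpow_const fun t => Or.inl (norm_ne_zero_iff.mpr (hne t))
  · refine Complex.continuous_exp.comp (Continuous.mul continuous_const ?_)
    exact (Continuous.div continuous_const hc hne).sub (by fun_prop)

/-- Size of the integrand of `modeIntegral`: for `0 ≤ s ≤ 1`, `A ≥ 0`, `y > 0`,
`‖(t+iy)⁻² |t+iy|^{−2s} e(−A/(t+iy) − Bt)‖ ≤ max(1, y⁻²) (t² + y²)⁻¹`.
[cite: IwaniecKowalski2004, §14.2 (proof of Lemma 14.2)] -/
theorem norm_modeIntegrand_le {s A y : ℝ} (hs0 : 0 ≤ s) (hs1 : s ≤ 1) (hA : 0 ≤ A) (hy : 0 < y)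
    (B t : ℝ) :
    ‖(((t : ℂ) + y * I) ^ 2)⁻¹ * ((‖(t : ℂ) + y * I‖ ^ (-(2 * s)) : ℝ) : ℂ) *
      cexp (2 * π * I * (-(A : ℂ) / ((t : ℂ) + y * I) - B * t))‖ ≤
      max 1 (y ^ (-2 : ℝ)) * (t ^ 2 + y ^ 2)⁻¹ := by
  have hW : 0 < ((t : ℂ) + y * I).im := by simp [hy]
  have hnorm : ‖(t : ℂ) + y * I‖ ^ 2 = t ^ 2 + y ^ 2 := by
    rw [Complex.sq_norm, Complex.normSq_add_mul_I]
  have hyle : y ≤ ‖(t : ℂ) + y * I‖ := by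
    simpa using Complex.im_le_norm ((t : ℂ) + y * I)
  have h1 : ‖(((t : ℂ) + y * I) ^ 2)⁻¹‖ = (t ^ 2 + y ^ 2)⁻¹ := by
    rw [norm_inv, norm_pow, hnorm]
  have h2 : ‖(((‖(t : ℂ) + y * I‖ ^ (-(2 * s)) : ℝ) : ℂ))‖ ≤ max 1 (y ^ (-2 : ℝ)) := by
    rw [Complex.norm_real, Real.norm_of_nonneg (Real.rpow_nonneg (norm_nonneg _) _)]
    exact (Real.rpow_le_rpow_of_nonpos hy hyle (by linarith)).trans
      (rpow_neg_two_mul_le_max hy hs0 hs1)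
  have h3 : ‖cexp (2 * π * I * (-(A : ℂ) / ((t : ℂ) + y * I) - B * t))‖ ≤ 1 := by
    have hsplit : cexp (2 * π * I * (-(A : ℂ) / ((t : ℂ) + y * I) - B * t)) =
        cexp (2 * π * I * (-(A : ℂ) / ((t : ℂ) + y * I))) * cexp (((-(2 * π * B * t)) : ℝ) * I) := by
      rw [← Complex.exp_add]; congr 1; push_cast; ring
    rw [hsplit, norm_mul, Complex.norm_exp_ofReal_mul_I, mul_one]
    exact norm_cexp_neg_div_le_one hA hW
  rw [norm_mul, norm_mul, h1]
  calc (t ^ 2 + y ^ 2)⁻¹ * ‖(((‖(t : ℂ) + y * I‖ ^ (-(2 * s)) : ℝ) : ℂ))‖ *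
        ‖cexp (2 * π * I * (-(A : ℂ) / ((t : ℂ) + y * I) - B * t))‖
      ≤ (t ^ 2 + y ^ 2)⁻¹ * max 1 (y ^ (-2 : ℝ)) * 1 := by gcongr
    _ = max 1 (y ^ (-2 : ℝ)) * (t ^ 2 + y ^ 2)⁻¹ := by ring

/-- **The limit `s → 0⁺` of the cell integral**: `I_s(A, B; y) → I_0(A, B; y)` (dominated
convergence with the majorant `max(1, y⁻²)(t²+y²)⁻¹` on `0 < s ≤ 1`).
[cite: IwaniecKowalski2004, §14.2 (proof of Lemma 14.2) with §3.2] -/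
theorem tendsto_modeIntegral_nhdsGT_zero {A y : ℝ} (hA : 0 ≤ A) (hy : 0 < y) (B : ℝ) :
    Tendsto (fun s : ℝ => modeIntegral s A B y) (𝓝[>] 0) (𝓝 (modeIntegral 0 A B y)) := by
  unfold modeIntegral
  refine tendsto_integral_filter_of_dominated_convergence
    (fun t : ℝ => max 1 (y ^ (-2 : ℝ)) * (t ^ 2 + y ^ 2)⁻¹) ?_ ?_ ?_ ?_
  · exact Eventually.of_forall fun s => (continuous_modeIntegrand s A B hy).aestronglyMeasurable
  · filter_upwards [Ioo_mem_nhdsGT (zero_lt_one' ℝ)] with s hs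
    exact Eventually.of_forall fun t => norm_modeIntegrand_le hs.1.le hs.2.le hA hy B t
  · exact (Literature.Analysis.SpecialFunctions.integrable_inv_sq_add_sq_of_ne_zero' hy.ne').const_mul _
  · refine Eventually.of_forall fun t => ?_
    have hne : (t : ℂ) + y * I ≠ 0 := add_mul_I_ne_zero_of_im (by simp; linarith)
    have hcont : Continuous fun s : ℝ => (((t : ℂ) + y * I) ^ 2)⁻¹ *
        ((‖(t : ℂ) + y * I‖ ^ (-(2 * s)) : ℝ) : ℂ) *
        cexp (2 * π * I * (-(A : ℂ) / ((t : ℂ) + y * I) - B * t)) := by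
      refine (continuous_const.mul (Complex.continuous_ofReal.comp ?_)).mul continuous_const
      exact (Real.continuous_const_rpow (norm_ne_zero_iff.mpr hne)).comp (by fun_prop)
    exact tendsto_nhdsWithin_of_tendsto_nhds (hcont.tendsto 0)

/-! ## The values at `s = 0` -/

/-- **The cell integral at `s = 0`, positive frequency**: for `A, B, y > 0`,
`I_0(A, B; y) = e^{−2πBy} · (−2π √(B/A) J₁(4π√(AB)))` (the tree's Lipschitz–Hankel evaluation
`weightTwo_besselModeIntegral`, after `e(−Bt) = e(−B(t+iy)) e^{−2πBy}`).
[cite: IwaniecKowalski2004, §14.2 (proof of Lemma 14.2)] -/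
theorem modeIntegral_zero_eq_of_pos {A B y : ℝ} (hA : 0 < A) (hB : 0 < B) (hy : 0 < y) :
    modeIntegral 0 A B y =
      cexp (-(2 * π * B * y : ℝ)) *
        ((-(2 * π * Real.sqrt (B / A) *
          Literature.Analysis.FunctionSpaces.besselJ 1 (4 * π * Real.sqrt (A * B))) : ℝ) : ℂ) := by
  rw [← Literature.NumberTheory.LFunctions.weightTwo_besselModeIntegral A B y hA hB hy,
    ← integral_const_mul]
  unfold modeIntegral
  refine integral_congr_ae (Eventually.of_forall fun t => ?_)
  have h0 : ((‖(t : ℂ) + y * I‖ ^ (-(2 * (0 : ℝ))) : ℝ) : ℂ) = 1 := by simp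
  dsimp only
  rw [h0, mul_one, mul_left_comm, ← Complex.exp_add]
  congr 2
  push_cast
  linear_combination (2 * π * B * y : ℂ) * Complex.I_sq

/-- **The cell integral at `s = 0`, non-positive frequency, vanishes**: for `A ≥ 0`, `B ≤ 0`,
`y > 0`, `I_0(A, B; y) = 0` — shift the line of integration to `Im t = Y` (no branch cut at
`s = 0`; `|e(−Bt)| = e^{2πB Im t} ≤ 1` there), where the integral is `≤ π/(y+Y) → 0`.
[cite: IwaniecKowalski2004, §14.2 (proof of Lemma 14.2: p_m(n) for n ≤ 0)] -/
theorem modeIntegral_zero_eq_zero_of_nonpos {A B y : ℝ} (hA : 0 ≤ A) (hB : B ≤ 0) (hy : 0 < y) :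
    modeIntegral 0 A B y = 0 := by
  -- the full integrand at `s = 0`, holomorphic on `Im w > -y`
  set g : ℂ → ℂ := fun w => modeKernel 0 A y w * cexp (((-(2 * π * B) : ℝ) : ℂ) * w * I) with hg
  have hI : modeIntegral 0 A B y = ∫ t : ℝ, g t := modeIntegral_eq_integral_modeKernel 0 A B y
  set b : ℝ → ℝ := fun x => (x ^ 2 + y ^ 2)⁻¹ with hb_def
  have hbi : Integrable b :=
    Literature.Analysis.SpecialFunctions.integrable_inv_sq_add_sq_of_ne_zero' hy.ne'
  have htop : Tendsto b atTop (𝓝 0) := by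
    have h1 : Tendsto (fun x : ℝ => x ^ 2 + y ^ 2) atTop atTop :=
      tendsto_atTop_add_const_right _ _ (tendsto_pow_atTop two_ne_zero)
    simpa [hb_def, Function.comp_def] using tendsto_inv_atTop_zero.comp h1
  have hbot : Tendsto b atBot (𝓝 0) := by
    have := htop.comp tendsto_neg_atBot_atTop
    refine this.congr fun t => ?_
    simp [hb_def, Function.comp]
  -- differentiability of `g` at every point with `Im w > -y`
  have hdiff : ∀ w : ℂ, -y < w.im → DifferentiableAt ℂ g w := by
    intro w hw
    have hW : w + y * I ≠ 0 := add_mul_I_ne_zero_of_im hw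
    have h1 : DifferentiableAt ℂ (fun w : ℂ => ((w + y * I) ^ 2)⁻¹) w :=
      ((differentiableAt_id.add_const _).pow 2).inv (pow_ne_zero 2 hW)
    have h2 : DifferentiableAt ℂ (fun w : ℂ => (w ^ 2 + (y : ℂ) ^ 2) ^ (-((0 : ℝ) : ℂ))) w := by
      simp only [Complex.ofReal_zero, neg_zero, Complex.cpow_zero]
      exact differentiableAt_const _
    have hd : DifferentiableAt ℂ (fun w : ℂ => w + y * I) w := differentiableAt_id.add_const _
    have h3 : DifferentiableAt ℂ (fun w : ℂ => cexp (2 * π * I * (-(A : ℂ) / (w + y * I)))) w :=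
      (((differentiableAt_const (-(A : ℂ))).div hd hW).const_mul (2 * π * I)).cexp
    have h4 : DifferentiableAt ℂ (fun w : ℂ => cexp (((-(2 * π * B) : ℝ) : ℂ) * w * I)) w := by
      fun_prop
    exact ((h1.mul h2).mul h3).mul h4
  -- the bound `‖g w‖ ≤ (Re w² + y²)⁻¹` for `Im w ≥ 0`
  have hgb' : ∀ w : ℂ, 0 ≤ w.im → ‖g w‖ ≤ (w.re ^ 2 + (w.im + y) ^ 2)⁻¹ := by
    intro w hw
    have hWpos : 0 < (w + y * I).im := by simp; linarith
    have e1 : (w + y * I).re = w.re := by simp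
    have e2 : (w + y * I).im = w.im + y := by simp
    have hsq : ‖w + y * I‖ ^ 2 = w.re ^ 2 + (w.im + y) ^ 2 := by
      rw [Complex.sq_norm, Complex.normSq_apply, e1, e2]; ring
    have h1 : ‖((w + y * I) ^ 2)⁻¹‖ = (w.re ^ 2 + (w.im + y) ^ 2)⁻¹ := by
      rw [norm_inv, norm_pow, hsq]
    have h2 : ‖(w ^ 2 + (y : ℂ) ^ 2) ^ (-((0 : ℝ) : ℂ))‖ = 1 := by simp
    have h3 : ‖cexp (2 * π * I * (-(A : ℂ) / (w + y * I)))‖ ≤ 1 := norm_cexp_neg_div_le_one hA hWpos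
    have h4 : ‖cexp (((-(2 * π * B) : ℝ) : ℂ) * w * I)‖ ≤ 1 := by
      rw [Complex.norm_exp, Real.exp_le_one_iff]
      have : ((((-(2 * π * B) : ℝ) : ℂ)) * w * I).re = 2 * π * B * w.im := by
        simp [Complex.mul_re, Complex.mul_im]
      rw [this]
      have : B * w.im ≤ 0 := mul_nonpos_of_nonpos_of_nonneg hB hw
      nlinarith [Real.pi_pos]
    simp only [hg, modeKernel]
    rw [norm_mul, norm_mul, norm_mul, h1, h2, mul_one]
    have hpos : 0 ≤ (w.re ^ 2 + (w.im + y) ^ 2)⁻¹ := by positivity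
    calc (w.re ^ 2 + (w.im + y) ^ 2)⁻¹ * ‖cexp (2 * π * I * (-(A : ℂ) / (w + y * I)))‖ *
          ‖cexp (((-(2 * π * B) : ℝ) : ℂ) * w * I)‖
        ≤ (w.re ^ 2 + (w.im + y) ^ 2)⁻¹ * 1 * 1 := by gcongr
      _ = (w.re ^ 2 + (w.im + y) ^ 2)⁻¹ := by ring
  have hgb : ∀ w : ℂ, 0 ≤ w.im → ‖g w‖ ≤ b w.re := by
    intro w hw
    refine (hgb' w hw).trans ?_
    simp only [hb_def]
    have hpos : 0 < w.re ^ 2 + y ^ 2 := by positivity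
    refine inv_anti₀ hpos ?_
    nlinarith [hw, hy]
  -- contour shift to height `Y`, for every `Y ≥ 0`
  have hshift : ∀ Y : ℝ, 0 ≤ Y → ‖∫ t : ℝ, g t‖ ≤ π / (y + Y) := by
    intro Y hY
    have hgc : ContinuousOn g {z : ℂ | 0 ≤ z.im ∧ z.im ≤ Y} := fun z hz =>
      (hdiff z (by linarith [hz.1])).continuousAt.continuousWithinAt
    have hgd : DifferentiableOn ℂ g {z : ℂ | 0 < z.im ∧ z.im < Y} := fun z hz =>
      (hdiff z (by linarith [hz.1])).differentiableWithinAt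
    have key := Literature.Analysis.Complex.norm_integral_le_of_strip hY hgc hgd
      (fun z h0 _ => hgb z h0) hbi htop hbot
    refine key.trans ?_
    have hyY : 0 < y + Y := by linarith
    have hline : ∀ t : ℝ, ‖g (t + Y * I)‖ ≤ (t ^ 2 + (y + Y) ^ 2)⁻¹ := by
      intro t
      have := hgb' (t + Y * I) (by simp [hY])
      simpa [add_comm Y y] using this
    calc ∫ t : ℝ, ‖g (t + Y * I)‖ ≤ ∫ t : ℝ, (t ^ 2 + (y + Y) ^ 2)⁻¹ :=
          integral_mono_of_nonneg (Eventually.of_forall fun _ => norm_nonneg _)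
            (Literature.Analysis.SpecialFunctions.integrable_inv_sq_add_sq_of_ne_zero' hyY.ne')
            (Eventually.of_forall hline)
      _ = π / (y + Y) := Literature.Analysis.SpecialFunctions.integral_inv_sq_add_sq_eq_pi_div' hyY
  -- let `Y → ∞`
  rw [hI]
  have hlim : Tendsto (fun Y : ℝ => π / (y + Y)) atTop (𝓝 0) :=
    tendsto_const_nhds.div_atTop (tendsto_atTop_add_const_left _ _ tendsto_id)
  have hle : ‖∫ t : ℝ, g t‖ ≤ 0 :=
    ge_of_tendsto hlim (Filter.eventually_atTop.2 ⟨0, fun Y hY => hshift Y hY⟩)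
  exact norm_le_zero_iff.mp hle

end Literature.NumberTheory.ModularForms.PoincareWeightTwo

end
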